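import Summits.QuantumFields.YangMills.Theorems.BalabanUVNodesN07JOfRecordGaugeCovariance
import Literature.MathematicalPhysics.QuantumFieldTheory.Balaban1983to89.B9Eq310DeltaPrime
import Literature.MathematicalPhysics.QuantumFieldTheory.Balaban1983to89.B9AdOrthogonal
import Summits.QuantumFields.YangMills.Theorems.UnitScaleTiltProp7V0CurrentCentralDerivT3
import HarnessLib

/-!
# NODE N07 — THE HESSIAN FORM (3.10) RESPECTS THE TRACE SECTORS AT `N = 2`: for a background of `2 × 2` units of determinant one, `⟨A, ΔB⟩ = ⟨B, ΔA⟩ = 0` whenever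
# `A` is traceless-valued and `B` is scalar-valued — `Re U(∂p)` is SCALAR (Cayley–Hamilton), transported scalars stay scalar, transported traceless letters stay traceless,
# and every commutator with a scalar vanishes ([B9] (3.2)–(3.4) pp. 390–391, (3.7) p. 391, (3.10) p. 392; [15] (51) p. 286 «for A′ with values in 𝔤 … D(A′) has values in 𝔤»)

Cell `pub-ymgap`, width seat `pub-ymgap-dag-n07-w3` (g26), CLAIM-14 (absorbs the withdrawn CLAIM-13).  `--kind proof --supports stmt-QuantumFields-27238 --as helper`; count-neutral.
[15] = [Balaban1985Variational]; [B9] = [Balaban1985BackgroundPropagators].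

WHY.  The trace half of def-Y's rows (`TY := evHerm0` keeps the trace; bus ruling 2026-08-31) needs every letter of the scheme of record to respect the splitting
`M₂(ℂ) = 𝔰𝔩₂ ⊕ ℂ·1` of the fibre.  The Hessian `Δ(U₀) = D*D + Δ′` is the first non-structural letter: its operator on the `L²` carriers is the Riesz operator of lit's
polarized form ✓`B9Eq310DeltaPrime.hessForm` (`B9Eq310HessianOperator.inner_curvOp`), so «`Δ(U₀)` maps traceless to traceless and scalar to scalar» is the statement that the
FORM vanishes on (traceless, scalar) and (scalar, traceless) pairs — proved here on plain bond functions, for every lattice, every `η`, every tracial datum `τ`, and every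
background of `2 × 2` units of determinant one (so every `SU(2)` background).

CONTENTS.
* §0 `det_coe_units_inv_of_det_eq_one` (any size), `det_coe_unitsOfRecord`; the `2 × 2` Cayley–Hamilton facts (`W + W⁻¹ = (tr W)·1`, `Re W` scalar, `Im W` traceless at `det = 1`) are the
  T³ lineage's ✓`Prop7V0CurrentCentralDeriv.val_add_val_inv_eq_trace_smul_one` ∕ `reC_eq_half_trace_smul_one_of_det_eq_one` ∕ `trace_imC_eq_zero_of_det_eq_one`, CITED (imported), not restated.
* §1 (any algebra `𝔸`, tracial `τ`) transported scalars are scalar and transported `τ`-traceless letters are `τ`-traceless: `adTransport_smul_one`, `edgeLin_scalar`, `curlAt_scalar`,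
  `tau_adTransport`, `tau_edgeLin_eq_zero`, `tau_curlAt_eq_zero`; `comm_smul_one_left∕right` bookkeeping.
* §2 (`M₂(ℂ)`, `det = 1`) `det_coe_plaqHolU`, ★`reHol_eq_smul_one` (`Re U(∂p) = ½ tr U(∂p)·1`).
* §3 ★`principalBlock_eq_zero_of_traceless_scalar` (+ `…_of_scalar_traceless`), ★`curvBlock₁_eq_zero_…` (both orders), ★`curvBlock₂_eq_zero_of_scalar_right∕left` (ANY `N`:
  a commutator with a scalar vanishes), ★★`curvForm_eq_zero_of_traceless_scalar`∕`_of_scalar_traceless`, ★★`hessForm_eq_zero_of_traceless_scalar`∕`_of_scalar_traceless`,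
  `hessForm_unitsOfRecord_eq_zero_of_traceless_scalar` (the record's `SU(2)` background, `τ = tr`).
* §4 ★ `JOfRecordAtBg_mem_herm0` — the `J`-ROW of def-Y's rows at `N = 2` (`J(U₀)(b) ∈ herm0 (Fin 2)` on every bond), BY NAME from this lineage's ✓`N07JOfRecordGaugeCovariance.
  trace_JOfRecordAtBg_apply_two` and def-Y's ✓`star_JOfRecordAtBg_apply`; with `TZ :=` the Hermitian traceless currents the row «`J(U₀) ∈ TZ`» holds.

HONEST LABELS.  Finite algebra on plain functions; no estimate; the operator-level corollary for `curvOp`∕`hessOp`∕`hessOpOfRecord` (via ✓`inner_curvOp` and single-bond test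
functions) and the other letters (`G₁`, `H₁`, `𝔊`, `π`, `C^{𝔰𝔩}`, `W`) are NOT here.  Count-neutral; N07 NOT discharged; P0 ⟨26900⟩ OPEN; R4 is the conditional finite-𝕋⁴ rung only.
Nothing here is a claim about the Yang–Mills mass gap (`Summit.QuantumFields`): finite torus, fixed `ε`; nothing continuum ∕ OS ∕ Clay.
-/

set_option autoImplicit false

noncomputable section

open scoped Matrix BigOperators

namespace Summit.QuantumFields.YangMills.Theorems.N07CurvFormTraceSU2

open Literature.MathematicalPhysics.QuantumFieldTheory.Balaban1983to89
open Literature.MathematicalPhysics.QuantumFieldTheory.Balaban1983to89.T4Continuum (T4Family)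
open T4Continuum BlockAveraging
open Node00
open B9SectCLatticeCarrier (Bond Plaq DirPair shift)
open B4Sect5Torus (TSite)
open B9Eq33CovDerivVector (adTransport adTransport_apply)
open B9Eq310DeltaPrime (plaqHolU reHol imHol edgeLin edgeLin_zero edgeLin_one edgeLin_two edgeLin_three curlAt curlAt_eq_smul_sum_edgeLin orderedPairs
  principalBlock principalBlock_apply curvBlock₁ curvBlock₁_apply curvBlock₂ curvBlock₂_apply curvForm curvForm_apply hessForm hessForm_apply)
open B9Eq37Insertion (reC imC)
open B9AdOrthogonal (herm0 mem_herm0)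
open B11Eq115Space (NegSup levWeight)

/-! ## §0  Determinants of inverses and of the units of record -/

/-- A unit of matrices with `det W = 1` has `det W⁻¹ = 1`. [folklore] [cite: Balaban1985BackgroundPropagators, (3.5) p.391] -/
theorem det_coe_units_inv_of_det_eq_one {n : Type*} [Fintype n] [DecidableEq n] {W : (Matrix n n ℂ)ˣ} (hW : (W : Matrix n n ℂ).det = 1) :
    (((W⁻¹ : (Matrix n n ℂ)ˣ)) : Matrix n n ℂ).det = 1 := by
  have h := congrArg Matrix.det W.inv_mul
  rwa [Matrix.det_mul, hW, mul_one, Matrix.det_one] at h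

/-- `det U₀(b) = 1` for the units of record (`U₀(b) ∈ SU(N)`). [cite: Balaban1985BackgroundPropagators, (3.1) p.390] -/
theorem det_coe_unitsOfRecord (F : T4Family) (N : ℕ) (K : ℕ) (U₀ : GaugeField (F.P K) 0 (SU N)) (a : Bond (F.P K).d (fun _ => (F.P K).sitesPerDir 0)) :
    ((unitsOfRecord F N U₀ a : (Matrix (Fin N) (Fin N) ℂ)ˣ) : Matrix (Fin N) (Fin N) ℂ).det = 1 := by
  rw [coe_unitsOfRecord]
  exact (Matrix.mem_specialUnitaryGroup_iff.mp (U₀ _).prop).2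

/-! ## §1  Transported scalars are scalar; transported `τ`-traceless letters are `τ`-traceless -/

section Generic

variable {d : ℕ} {Pd : Fin d → ℕ} {𝔸 : Type*} [Ring 𝔸] [Algebra ℂ 𝔸] (τ : 𝔸 →ₗ[ℂ] ℂ) (U : Bond d Pd → 𝔸ˣ)

omit [Algebra ℂ 𝔸] in
/-- `W·(r·1)·W⁻¹ = r·1` in any algebra: conjugation fixes scalars. [folklore] [cite: Balaban1985BackgroundPropagators, p.390 («R(U)X = UXU⁻¹»)] -/
theorem units_mul_smul_one_mul_inv [Algebra ℂ 𝔸] (W : 𝔸ˣ) (r : ℂ) : (W : 𝔸) * (r • (1 : 𝔸)) * ((W⁻¹ : 𝔸ˣ) : 𝔸) = r • (1 : 𝔸) := by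
  rw [mul_smul_comm, smul_mul_assoc, mul_one, Units.mul_inv]

/-- `R(U(b))(r·1) = r·1`. [cite: Balaban1985BackgroundPropagators, p.390] -/
theorem adTransport_smul_one (b : Bond d Pd) (r : ℂ) : adTransport (𝕜 := ℂ) U b (r • (1 : 𝔸)) = r • (1 : 𝔸) := by
  rw [adTransport_apply, units_mul_smul_one_mul_inv]

/-- **The transported edge variables of a SCALAR-valued bond function are scalar.** [cite: Balaban1985BackgroundPropagators, (3.2) p.390] -/
theorem edgeLin_scalar {B : Bond d Pd → 𝔸} {c : Bond d Pd → ℂ} (hB : ∀ b, B b = c b • (1 : 𝔸)) (p : Plaq d Pd) (k : Fin 4) :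
    ∃ r : ℂ, edgeLin U p k B = r • (1 : 𝔸) := by
  obtain ⟨x, q⟩ := p
  fin_cases k
  · refine ⟨-c (shift q.1.2 x, q.1.1), ?_⟩
    rw [show ((⟨0, by norm_num⟩ : Fin 4)) = 0 from rfl, edgeLin_zero, hB, units_mul_smul_one_mul_inv, neg_smul]
  · refine ⟨-c (x, q.1.2), ?_⟩
    rw [show ((⟨1, by norm_num⟩ : Fin 4)) = 1 from rfl, edgeLin_one, hB, neg_smul]
  · refine ⟨c (x, q.1.1), ?_⟩
    rw [show ((⟨2, by norm_num⟩ : Fin 4)) = 2 from rfl, edgeLin_two, hB]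
  · refine ⟨c (shift q.1.1 x, q.1.2), ?_⟩
    rw [show ((⟨3, by norm_num⟩ : Fin 4)) = 3 from rfl, edgeLin_three, hB, units_mul_smul_one_mul_inv]

/-- **The covariant curl of a scalar-valued bond function is scalar at every plaquette.** [cite: Balaban1985BackgroundPropagators, (3.4) p.391] -/
theorem curlAt_scalar {B : Bond d Pd → 𝔸} {c : Bond d Pd → ℂ} (hB : ∀ b, B b = c b • (1 : 𝔸)) (a : ℂ) (p : Plaq d Pd) :
    ∃ r : ℂ, curlAt a U p B = r • (1 : 𝔸) := by
  choose r hr using edgeLin_scalar U hB p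
  refine ⟨a * ∑ k, r k, ?_⟩
  rw [curlAt_eq_smul_sum_edgeLin, Finset.sum_congr rfl fun k _ => hr k, ← Finset.sum_smul, smul_smul]

/-- `τ(W X W⁻¹) = τ X` for a tracial `τ`. [cite: Balaban1985BackgroundPropagators, (3.2) p.391] -/
theorem tau_adTransport (hτ : ∀ a b : 𝔸, τ (a * b) = τ (b * a)) (b : Bond d Pd) (X : 𝔸) : τ (adTransport (𝕜 := ℂ) U b X) = τ X := by
  rw [adTransport_apply, hτ, ← mul_assoc, Units.inv_mul, one_mul]

/-- **The transported edge variables of a `τ`-TRACELESS bond function are `τ`-traceless** (tracial `τ`). [cite: Balaban1985BackgroundPropagators, (3.2) p.390; Balaban1985Variational, (51) p.286] -/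
theorem tau_edgeLin_eq_zero (hτ : ∀ a b : 𝔸, τ (a * b) = τ (b * a)) {A : Bond d Pd → 𝔸} (hA : ∀ b, τ (A b) = 0) (p : Plaq d Pd) (k : Fin 4) :
    τ (edgeLin U p k A) = 0 := by
  obtain ⟨x, q⟩ := p
  fin_cases k
  · rw [show ((⟨0, by norm_num⟩ : Fin 4)) = 0 from rfl, edgeLin_zero, map_neg, ← adTransport_apply (𝕜 := ℂ), tau_adTransport τ U hτ, hA, neg_zero]
  · rw [show ((⟨1, by norm_num⟩ : Fin 4)) = 1 from rfl, edgeLin_one, map_neg, hA, neg_zero]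
  · rw [show ((⟨2, by norm_num⟩ : Fin 4)) = 2 from rfl, edgeLin_two, hA]
  · rw [show ((⟨3, by norm_num⟩ : Fin 4)) = 3 from rfl, edgeLin_three, ← adTransport_apply (𝕜 := ℂ), tau_adTransport τ U hτ, hA]

/-- **The covariant curl of a `τ`-traceless bond function is `τ`-traceless.** [cite: Balaban1985BackgroundPropagators, (3.4) p.391; Balaban1985Variational, (51) p.286] -/
theorem tau_curlAt_eq_zero (hτ : ∀ a b : 𝔸, τ (a * b) = τ (b * a)) {A : Bond d Pd → 𝔸} (hA : ∀ b, τ (A b) = 0) (a : ℂ) (p : Plaq d Pd) :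
    τ (curlAt a U p A) = 0 := by
  rw [curlAt_eq_smul_sum_edgeLin, map_smul, map_sum, Finset.sum_eq_zero fun k _ => tau_edgeLin_eq_zero τ U hτ hA p k, smul_zero]

/-- ★ **THE COMMUTATOR BLOCK OF (3.10) VANISHES WHEN THE RIGHT ARGUMENT IS SCALAR-VALUED** (every `N`: `[A′(b₁), r·1] = 0`). [cite: Balaban1985BackgroundPropagators, (3.10) p.392] -/
theorem curvBlock₂_eq_zero_of_scalar_right (η : ℝ) (p : Plaq d Pd) (A : Bond d Pd → 𝔸) {B : Bond d Pd → 𝔸} {c : Bond d Pd → ℂ}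
    (hB : ∀ b, B b = c b • (1 : 𝔸)) : curvBlock₂ τ η U p A B = 0 := by
  rw [curvBlock₂_apply]
  refine Finset.sum_eq_zero fun kl _ => ?_
  obtain ⟨r₁, h₁⟩ := edgeLin_scalar U hB p kl.1
  obtain ⟨r₂, h₂⟩ := edgeLin_scalar U hB p kl.2
  rw [h₁, h₂]
  simp only [mul_smul_comm, smul_mul_assoc, mul_one, one_mul, sub_self, zero_mul, smul_zero, map_zero, add_zero, mul_zero]

/-- The commutator block vanishes when the LEFT argument is scalar-valued. [cite: Balaban1985BackgroundPropagators, (3.10) p.392] -/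
theorem curvBlock₂_eq_zero_of_scalar_left (η : ℝ) (p : Plaq d Pd) {A : Bond d Pd → 𝔸} {c : Bond d Pd → ℂ} (hA : ∀ b, A b = c b • (1 : 𝔸))
    (B : Bond d Pd → 𝔸) : curvBlock₂ τ η U p A B = 0 := by
  rw [curvBlock₂_apply]
  refine Finset.sum_eq_zero fun kl _ => ?_
  obtain ⟨r₁, h₁⟩ := edgeLin_scalar U hA p kl.1
  obtain ⟨r₂, h₂⟩ := edgeLin_scalar U hA p kl.2
  rw [h₁, h₂]
  simp only [mul_smul_comm, smul_mul_assoc, mul_one, one_mul, sub_self, zero_mul, smul_zero, map_zero, add_zero, mul_zero]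

/-- ★ **THE PRINCIPAL BLOCK `τ((DA)(p)(DB)(p))` VANISHES for `τ`-traceless `A` and scalar-valued `B`** (tracial `τ`). [cite: Balaban1985BackgroundPropagators, (3.10) p.392] -/
theorem principalBlock_eq_zero_of_traceless_scalar (hτ : ∀ a b : 𝔸, τ (a * b) = τ (b * a)) (η : ℝ) (p : Plaq d Pd) {A B : Bond d Pd → 𝔸}
    (hA : ∀ b, τ (A b) = 0) {c : Bond d Pd → ℂ} (hB : ∀ b, B b = c b • (1 : 𝔸)) : principalBlock τ η U p A B = 0 := by
  obtain ⟨r, hr⟩ := curlAt_scalar U hB (((η : ℂ))⁻¹) p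
  rw [principalBlock_apply, hr, mul_smul_comm, mul_one, map_smul, tau_curlAt_eq_zero τ U hτ hA, smul_zero]

/-- … and for scalar-valued `A`, `τ`-traceless `B`. [cite: Balaban1985BackgroundPropagators, (3.10) p.392] -/
theorem principalBlock_eq_zero_of_scalar_traceless (hτ : ∀ a b : 𝔸, τ (a * b) = τ (b * a)) (η : ℝ) (p : Plaq d Pd) {A B : Bond d Pd → 𝔸}
    {c : Bond d Pd → ℂ} (hA : ∀ b, A b = c b • (1 : 𝔸)) (hB : ∀ b, τ (B b) = 0) : principalBlock τ η U p A B = 0 := by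
  obtain ⟨r, hr⟩ := curlAt_scalar U hA (((η : ℂ))⁻¹) p
  rw [principalBlock_apply, hr, smul_mul_assoc, one_mul, map_smul, tau_curlAt_eq_zero τ U hτ hB, smul_zero]

/-- The first block vanishes for `τ`-traceless `A`, scalar `B`, PROVIDED `Re U(∂p)` is scalar. [cite: Balaban1985BackgroundPropagators, (3.10) p.392] -/
theorem curvBlock₁_eq_zero_of_traceless_scalar_of_reHol (hτ : ∀ a b : 𝔸, τ (a * b) = τ (b * a)) (η : ℝ) (p : Plaq d Pd) {s : ℂ}
    (hre : reHol U p = s • (1 : 𝔸)) {A B : Bond d Pd → 𝔸} (hA : ∀ b, τ (A b) = 0) {c : Bond d Pd → ℂ} (hB : ∀ b, B b = c b • (1 : 𝔸)) :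
    curvBlock₁ τ η U p A B = 0 := by
  obtain ⟨r, hr⟩ := curlAt_scalar U hB (((η : ℂ))⁻¹) p
  have hz : reHol U p - 1 = (s - 1) • (1 : 𝔸) := by rw [hre, sub_smul, one_smul]
  rw [curvBlock₁_apply, hr, hz]
  simp only [mul_smul_comm, smul_mul_assoc, mul_one, one_mul, map_smul, tau_curlAt_eq_zero τ U hτ hA, smul_zero, add_zero, mul_zero]

/-- … and for scalar `A`, `τ`-traceless `B`, `Re U(∂p)` scalar. [cite: Balaban1985BackgroundPropagators, (3.10) p.392] -/
theorem curvBlock₁_eq_zero_of_scalar_traceless_of_reHol (hτ : ∀ a b : 𝔸, τ (a * b) = τ (b * a)) (η : ℝ) (p : Plaq d Pd) {s : ℂ}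
    (hre : reHol U p = s • (1 : 𝔸)) {A B : Bond d Pd → 𝔸} {c : Bond d Pd → ℂ} (hA : ∀ b, A b = c b • (1 : 𝔸)) (hB : ∀ b, τ (B b) = 0) :
    curvBlock₁ τ η U p A B = 0 := by
  obtain ⟨r, hr⟩ := curlAt_scalar U hA (((η : ℂ))⁻¹) p
  have hz : reHol U p - 1 = (s - 1) • (1 : 𝔸) := by rw [hre, sub_smul, one_smul]
  rw [curvBlock₁_apply, hr, hz]
  simp only [mul_smul_comm, smul_mul_assoc, mul_one, one_mul, map_smul, tau_curlAt_eq_zero τ U hτ hB, smul_zero, add_zero, mul_zero]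

end Generic

/-! ## §2  `2 × 2` backgrounds of determinant one: `Re U(∂p)` is scalar -/

section SU2

variable {d : ℕ} {Pd : Fin d → ℕ} (τ : Matrix (Fin 2) (Fin 2) ℂ →ₗ[ℂ] ℂ) (U : Bond d Pd → (Matrix (Fin 2) (Fin 2) ℂ)ˣ)

/-- `det U(∂p) = 1` when every `det U(b) = 1`. [cite: Balaban1985BackgroundPropagators, (3.1) p.390] -/
theorem det_coe_plaqHolU (hU : ∀ b, ((U b : (Matrix (Fin 2) (Fin 2) ℂ)ˣ) : Matrix (Fin 2) (Fin 2) ℂ).det = 1) (p : Plaq d Pd) :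
    ((plaqHolU U p : (Matrix (Fin 2) (Fin 2) ℂ)ˣ) : Matrix (Fin 2) (Fin 2) ℂ).det = 1 := by
  simp only [plaqHolU, Units.val_mul, Matrix.det_mul, hU, det_coe_units_inv_of_det_eq_one (hU _), mul_one]

/-- ★ **`Re U(∂p) = ½(tr U(∂p))·1` IS SCALAR at a background of `2 × 2` units of determinant one** (Cayley–Hamilton, ✓`Prop7V0CurrentCentralDeriv.val_add_val_inv_eq_trace_smul_one`).
[cite: Balaban1985BackgroundPropagators, (3.7) p.391, (3.10) p.392] -/
theorem reHol_eq_smul_one (hU : ∀ b, ((U b : (Matrix (Fin 2) (Fin 2) ℂ)ˣ) : Matrix (Fin 2) (Fin 2) ℂ).det = 1) (p : Plaq d Pd) :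
    reHol U p = ((1 / 2 : ℂ) * ((plaqHolU U p : (Matrix (Fin 2) (Fin 2) ℂ)ˣ) : Matrix (Fin 2) (Fin 2) ℂ).trace) • (1 : Matrix (Fin 2) (Fin 2) ℂ) := by
  rw [reHol, Prop7V0CurrentCentralDeriv.val_add_val_inv_eq_trace_smul_one _ (det_coe_plaqHolU U hU p), smul_smul]

/-! ## §3  The forms vanish on (traceless, scalar) and (scalar, traceless) pairs -/

/-- ★★ **THE CURVATURE FORM (3.10) VANISHES ON (`τ`-TRACELESS, SCALAR) PAIRS** at a background of `2 × 2` units of determinant one, tracial `τ`.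
[cite: Balaban1985BackgroundPropagators, (3.10) p.392; Balaban1985Variational, (51) p.286] -/
theorem curvForm_eq_zero_of_traceless_scalar (hτ : ∀ a b : Matrix (Fin 2) (Fin 2) ℂ, τ (a * b) = τ (b * a))
    (hU : ∀ b, ((U b : (Matrix (Fin 2) (Fin 2) ℂ)ˣ) : Matrix (Fin 2) (Fin 2) ℂ).det = 1) (η : ℝ) {A B : Bond d Pd → Matrix (Fin 2) (Fin 2) ℂ}
    (hA : ∀ b, τ (A b) = 0) {c : Bond d Pd → ℂ} (hB : ∀ b, B b = c b • (1 : Matrix (Fin 2) (Fin 2) ℂ)) : curvForm τ η U A B = 0 := by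
  rw [curvForm_apply]
  refine Finset.sum_eq_zero fun p _ => ?_
  rw [curvBlock₁_eq_zero_of_traceless_scalar_of_reHol τ U hτ η p (reHol_eq_smul_one U hU p) hA hB, curvBlock₂_eq_zero_of_scalar_right τ U η p A hB,
    add_zero, mul_zero]

/-- ★★ … and on (SCALAR, `τ`-TRACELESS) pairs. [cite: Balaban1985BackgroundPropagators, (3.10) p.392; Balaban1985Variational, (51) p.286] -/
theorem curvForm_eq_zero_of_scalar_traceless (hτ : ∀ a b : Matrix (Fin 2) (Fin 2) ℂ, τ (a * b) = τ (b * a))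
    (hU : ∀ b, ((U b : (Matrix (Fin 2) (Fin 2) ℂ)ˣ) : Matrix (Fin 2) (Fin 2) ℂ).det = 1) (η : ℝ) {A B : Bond d Pd → Matrix (Fin 2) (Fin 2) ℂ}
    {c : Bond d Pd → ℂ} (hA : ∀ b, A b = c b • (1 : Matrix (Fin 2) (Fin 2) ℂ)) (hB : ∀ b, τ (B b) = 0) : curvForm τ η U A B = 0 := by
  rw [curvForm_apply]
  refine Finset.sum_eq_zero fun p _ => ?_
  rw [curvBlock₁_eq_zero_of_scalar_traceless_of_reHol τ U hτ η p (reHol_eq_smul_one U hU p) hA hB, curvBlock₂_eq_zero_of_scalar_left τ U η p hA B,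
    add_zero, mul_zero]

/-- ★★ **THE HESSIAN FORM `⟨A, ΔB⟩` OF (3.7)∕(3.10) VANISHES ON (`τ`-TRACELESS, SCALAR) PAIRS** at a background of `2 × 2` units of determinant one: `Δ^η(U) = D*D + Δ′`
does not couple the traceless sector to the scalar sector at `N = 2`. [cite: Balaban1985BackgroundPropagators, (3.7) p.391, (3.10) p.392; Balaban1985Variational, (51) p.286] -/
theorem hessForm_eq_zero_of_traceless_scalar (hτ : ∀ a b : Matrix (Fin 2) (Fin 2) ℂ, τ (a * b) = τ (b * a))
    (hU : ∀ b, ((U b : (Matrix (Fin 2) (Fin 2) ℂ)ˣ) : Matrix (Fin 2) (Fin 2) ℂ).det = 1) (η : ℝ) {A B : Bond d Pd → Matrix (Fin 2) (Fin 2) ℂ}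
    (hA : ∀ b, τ (A b) = 0) {c : Bond d Pd → ℂ} (hB : ∀ b, B b = c b • (1 : Matrix (Fin 2) (Fin 2) ℂ)) : hessForm τ η U A B = 0 := by
  rw [hessForm_apply, curvForm_eq_zero_of_traceless_scalar τ U hτ hU η hA hB, add_zero]
  refine Finset.sum_eq_zero fun p _ => ?_
  have h := principalBlock_eq_zero_of_traceless_scalar τ U hτ η p hA hB
  rw [principalBlock_apply] at h
  rw [h, mul_zero]

/-- ★★ … and on (SCALAR, `τ`-TRACELESS) pairs. [cite: Balaban1985BackgroundPropagators, (3.7) p.391, (3.10) p.392; Balaban1985Variational, (51) p.286] -/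
theorem hessForm_eq_zero_of_scalar_traceless (hτ : ∀ a b : Matrix (Fin 2) (Fin 2) ℂ, τ (a * b) = τ (b * a))
    (hU : ∀ b, ((U b : (Matrix (Fin 2) (Fin 2) ℂ)ˣ) : Matrix (Fin 2) (Fin 2) ℂ).det = 1) (η : ℝ) {A B : Bond d Pd → Matrix (Fin 2) (Fin 2) ℂ}
    {c : Bond d Pd → ℂ} (hA : ∀ b, A b = c b • (1 : Matrix (Fin 2) (Fin 2) ℂ)) (hB : ∀ b, τ (B b) = 0) : hessForm τ η U A B = 0 := by
  rw [hessForm_apply, curvForm_eq_zero_of_scalar_traceless τ U hτ hU η hA hB, add_zero]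
  refine Finset.sum_eq_zero fun p _ => ?_
  have h := principalBlock_eq_zero_of_scalar_traceless τ U hτ η p hA hB
  rw [principalBlock_apply] at h
  rw [h, mul_zero]

/-- **At the record's `SU(2)` background**: the Hessian form of `Δ(U₀)` vanishes on (traceless, scalar) pairs for the units of record `unitsOfRecord F 2 U₀` and `τ = tr`.
[cite: Balaban1985BackgroundPropagators, (3.10) p.392; Balaban1985Variational, (51) p.286] -/
theorem hessForm_unitsOfRecord_eq_zero_of_traceless_scalar (F : T4Family) (K : ℕ) (U₀ : GaugeField (F.P K) 0 (SU 2)) (η : ℝ)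
    {A B : Bond (F.P K).d (fun _ => (F.P K).sitesPerDir 0) → Matrix (Fin 2) (Fin 2) ℂ} (hA : ∀ b, (A b).trace = 0) {c : _ → ℂ}
    (hB : ∀ b, B b = c b • (1 : Matrix (Fin 2) (Fin 2) ℂ)) :
    hessForm (Matrix.traceLinearMap (Fin 2) ℂ ℂ) η (Node00.unitsOfRecord F 2 U₀) A B = 0 ∧
      hessForm (Matrix.traceLinearMap (Fin 2) ℂ ℂ) η (Node00.unitsOfRecord F 2 U₀) B A = 0 :=
  ⟨hessForm_eq_zero_of_traceless_scalar _ _ (fun a b => Matrix.trace_mul_comm a b) (det_coe_unitsOfRecord F 2 K U₀) η hA hB,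
    hessForm_eq_zero_of_scalar_traceless _ _ (fun a b => Matrix.trace_mul_comm a b) (det_coe_unitsOfRecord F 2 K U₀) η hB hA⟩

end SU2

/-! ## §4  The `J`-row of def-Y's rows at `N = 2` -/

section JRow

variable (F : T4Family) (K : ℕ) (k : ℕ) (Ω : ℕ → Set (Site (F.P K) 0)) (U₀ : GaugeField (F.P K) 0 (SU 2)) [Fact (0 < (F.L : ℝ))] [Fact (0 < (F.P K).eta k)]

/-- ★ **THE `J`-ROW AT THE RECORD `N = 2`**: on every bond `J(U₀)(b)` is HERMITIAN AND TRACELESS — `J(U₀)(b) ∈ herm0 (Fin 2)`, the fibre of def-Y's `ev`-presented real sector (BY NAME: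
✓`star_JOfRecordAtBg_apply`, ✓`N07JOfRecordGaugeCovariance.trace_JOfRecordAtBg_apply_two`); so with `TZ :=` the Hermitian traceless currents the row «`J(U₀) ∈ TZ`» of
✓`Node00.BgSchemeChartLie.lieTokAt_of_rows` holds at the scheme of record. [cite: Balaban1985Variational, (27)–(28) p.282, Prop. 6 p.295] -/
theorem JOfRecordAtBg_mem_herm0 (b : Bond (F.P K).d (fun _ => (F.P K).sitesPerDir 0)) :
    NegSup.equiv (levWeight (F.L : ℝ) ((F.P K).eta k) (bondLevLit F Ω k) 3) (Matrix (Fin 2) (Fin 2) ℂ) (JOfRecordAtBg F 2 K k Ω U₀) b ∈ herm0 (Fin 2) := by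
  rw [mem_herm0]
  refine ⟨?_, N07JOfRecordGaugeCovariance.trace_JOfRecordAtBg_apply_two (F := F) (K := K) (k := k) (Ω := Ω) U₀ b⟩
  have h := star_JOfRecordAtBg_apply (F := F) (N := 2) (K := K) (k := k) (Ω := Ω) (U₀ := U₀) b
  rwa [Matrix.star_eq_conjTranspose] at h

end JRow

end Summit.QuantumFields.YangMills.Theorems.N07CurvFormTraceSU2

end
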